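import Summits.AtomisticToContinuum.HydrodynamicLimit.Theorems.CollisionIsometryCLTAdaptedWeightCLTBHEntropyBudgetDerivEnt

/-!
# Entropy budget (stub `stub_entropyBudget`, line `block-h-dissipation-closure`, crux `AdaptedWeightCLT`,
stmt-AtomisticToContinuum-14868; `--supports`) — helper 9: the integrated size of the transported entropy
density, `|D_x| ≤ B₁ · R(V, h, δ)`

Integrating the master pointwise bound of helper 6 against the Gaussian moments of orders `0, 2, 4`
(helper 1) gives `∫ |(1 + log f̂) dF| dv ≤ B₁ · Q(V,h,δ)` with `B₁ = Σ_i |β_i|` and an explicit `Q` that depends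
on the configuration only through a velocity bound `V` (the KDE integrals are convex combinations of
single-Gaussian ones; the floor's polynomial factor is bounded by `a₀ + a₁ |v−ū|²`; temperatures lie in
`[h², h² + (2V)²/3]`). Hence the transported mass-weighted entropy density of helper 8 obeys
`|D_x| ≤ B₁ · (M(V,h,δ) + Q(V,h,δ))`, and `B₁ ≤ L V #{i : cw_i(x) ≠ 0}` (helper 4): `D_x` vanishes off the
kernel supports — the source of the factor `(N+1)^{γc}` of the transport term.
-/

namespace Summit.AtomisticToContinuum.HydrodynamicLimit.Theorems.BlockHDissipation

open scoped BigOperators Topology Classical MeasureTheory ENNReal InnerProductSpace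
open Filter Set MeasureTheory ProbabilityTheory
open Literature.Analysis.FluidPDE
open Literature.Analysis.FunctionSpaces (Torus.IsSmooth)
open Summit.AtomisticToContinuum.HydrodynamicLimit.Theorems.ContactSourceDuhamel (T3 V3 Cfg Vel Flow Flows)
open Literature.MathematicalPhysics.KineticTheory (localMaxwellian_pos localMaxwellian_nonneg continuous_localMaxwellian)

noncomputable section

namespace EntropyBudget

variable {N : ℕ} {ψ : ℕ → T3 → ℝ} {h δ : ℝ} (w : Cfg N) (x : T3)

/-! ## Gaussian integrals of the weights appearing in the master bound -/

/-- `∫ M_{θ,u}(v) (A + B |v − c|²) dv = A + B (3θ + |u − c|²)`. -/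
theorem integral_lM_mul_affine_sq {θ : ℝ} (hθ : 0 < θ) (u c : V3) (A B : ℝ) :
    ∫ v, localMaxwellian 1 θ u v * (A + B * ‖v - c‖ ^ 2) = A + B * (3 * θ + ‖u - c‖ ^ 2) := by
  have h1 := integrable_lM hθ u
  have h2 := integrable_lM_mul_norm_sub_pow hθ u c 2
  have e : (fun v => localMaxwellian 1 θ u v * (A + B * ‖v - c‖ ^ 2)) =
      fun v => A * localMaxwellian 1 θ u v + B * (localMaxwellian 1 θ u v * ‖v - c‖ ^ 2) := by
    funext v; ring
  have hA : Integrable fun v => A * localMaxwellian 1 θ u v := h1.const_mul A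
  have hB : Integrable fun v => B * (localMaxwellian 1 θ u v * ‖v - c‖ ^ 2) := h2.const_mul B
  rw [e, integral_add hA hB, integral_const_mul, integral_const_mul, integral_lM hθ,
    integral_lM_mul_norm_sub_sq' hθ, mul_one]

/-- `∫ M_{θ,u}(v) (A + B |v − u|² + C |v − u|⁴) dv = A + 3Bθ + C K₄ θ²`. -/
theorem integral_lM_mul_quad {θ : ℝ} (hθ : 0 < θ) (u : V3) (A B C : ℝ) :
    ∫ v, localMaxwellian 1 θ u v * (A + B * ‖v - u‖ ^ 2 + C * ‖v - u‖ ^ 4) =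
      A + B * (3 * θ) + C * ((∫ w, ‖w‖ ^ 4 ∂stdGaussian V3) * θ ^ 2) := by
  have h1 := integrable_lM hθ u
  have h2 := integrable_lM_mul_norm_sub_pow hθ u u 2
  have h4 := integrable_lM_mul_norm_sub_pow hθ u u 4
  have e : (fun v => localMaxwellian 1 θ u v * (A + B * ‖v - u‖ ^ 2 + C * ‖v - u‖ ^ 4)) =
      fun v => (A * localMaxwellian 1 θ u v + B * (localMaxwellian 1 θ u v * ‖v - u‖ ^ 2)) +
        C * (localMaxwellian 1 θ u v * ‖v - u‖ ^ 4) := by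
    funext v; ring
  have hAB : Integrable fun v => A * localMaxwellian 1 θ u v + B * (localMaxwellian 1 θ u v * ‖v - u‖ ^ 2) :=
    (h1.const_mul A).add (h2.const_mul B)
  rw [e, integral_add hAB (h4.const_mul C), integral_add (h1.const_mul A) (h2.const_mul B), integral_const_mul,
    integral_const_mul, integral_const_mul, integral_lM hθ, integral_lM_mul_norm_sub_sq' hθ,
    integral_lM_mul_norm_sub_pow_four hθ, sub_self, norm_zero]
  ring

/-- The KDE integral of an affine-in-`|v−ū|²` weight is a convex combination of the single-Gaussian ones,
hence at most their maximum: `∫ f̃ (A + B|v−ū|²) ≤ A + B (3h² + 4V²)` (`A, B ≥ 0`). -/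
theorem integral_kde_mul_affine_le (hψ : ∀ y, 0 ≤ ψ N y) (hh : 0 < h) {V : ℝ} (hV : ∀ i, ‖(w i).2‖ ≤ V)
    {A B : ℝ} (hA : 0 ≤ A) (hB : 0 ≤ B) :
    ∫ v, kde N ψ h w x v * (A + B * ‖v - cU N ψ w x‖ ^ 2) ≤ A + B * (3 * h ^ 2 + 4 * V ^ 2) := by
  have hh2 : 0 < h ^ 2 := by positivity
  by_cases hS : cW N ψ w x = 0
  · have : (fun v => kde N ψ h w x v * (A + B * ‖v - cU N ψ w x‖ ^ 2)) = fun _ => 0 := by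
      funext v; rw [kde_of_cW_eq_zero w x hS, zero_mul]
    rw [this, integral_zero]
    positivity
  have hSpos : 0 < cW N ψ w x := lt_of_le_of_ne (cW_nonneg w x hψ) (Ne.symm hS)
  rw [integral_kde_mul w x fun i => integrable_lM_mul_poly hh2 _ A B _ 2]
  have hi : ∀ i, ∫ v, gauss h (w i).2 v * (A + B * ‖v - cU N ψ w x‖ ^ 2) ≤ A + B * (3 * h ^ 2 + 4 * V ^ 2) := by
    intro i
    show ∫ v, localMaxwellian 1 (h ^ 2) (w i).2 v * (A + B * ‖v - cU N ψ w x‖ ^ 2) ≤ _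
    rw [integral_lM_mul_affine_sq hh2]
    have : ‖(w i).2 - cU N ψ w x‖ ^ 2 ≤ (2 * V) ^ 2 := pow_le_pow_left₀ (norm_nonneg _) (norm_vel_sub_cU_le w x hψ hV i) 2
    nlinarith
  calc (cW N ψ w x)⁻¹ * ∑ i, cw N ψ w x i * ∫ v, gauss h (w i).2 v * (A + B * ‖v - cU N ψ w x‖ ^ 2)
      ≤ (cW N ψ w x)⁻¹ * ∑ i, cw N ψ w x i * (A + B * (3 * h ^ 2 + 4 * V ^ 2)) :=
        mul_le_mul_of_nonneg_left (Finset.sum_le_sum fun i _ => mul_le_mul_of_nonneg_left (hi i) (cw_nonneg w x hψ i))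
          (inv_pos.2 hSpos).le
    _ = A + B * (3 * h ^ 2 + 4 * V ^ 2) := by
        rw [← Finset.sum_mul, show (∑ i, cw N ψ w x i) = cW N ψ w x from rfl, ← mul_assoc, inv_mul_cancel₀ hS, one_mul]

/-- The floor's polynomial factor against an affine weight: pointwise
`(c₀ + q/(2h²)) ((8/3)V²(q/(2h⁴) + 3/(2h²)) + 2V√q/h²) ≤ c₀a₀ + (c₀a₁ + a₀/(2h²)) q + (a₁/(2h²)) q²`,
`a₀ = (4V²+V)/h²`, `a₁ = 4V²/(3h⁴) + V/h²` (`q = |v − ū|²`, `c₀ ≥ 0`). -/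
theorem weight_mul_floorPoly_le (hh : 0 < h) {V c₀ : ℝ} (hV0 : 0 ≤ V) (hc₀ : 0 ≤ c₀) (v u : V3) :
    (c₀ + ‖v - u‖ ^ 2 / (2 * h ^ 2)) * (8 / 3 * V ^ 2 * (‖v - u‖ ^ 2 / (2 * h ^ 4) + 3 / (2 * h ^ 2)) + 2 * V * ‖v - u‖ / h ^ 2) ≤
      c₀ * ((4 * V ^ 2 + V) / h ^ 2) + (c₀ * (4 * V ^ 2 / (3 * h ^ 4) + V / h ^ 2) + (4 * V ^ 2 + V) / h ^ 2 / (2 * h ^ 2)) *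
        ‖v - u‖ ^ 2 + (4 * V ^ 2 / (3 * h ^ 4) + V / h ^ 2) / (2 * h ^ 2) * ‖v - u‖ ^ 4 := by
  set q : ℝ := ‖v - u‖ ^ 2 with hq
  have hq0 : 0 ≤ ‖v - u‖ := norm_nonneg _
  have h1 : 2 * V * ‖v - u‖ ≤ V * (1 + q) := by rw [hq]; nlinarith only [sq_nonneg (‖v - u‖ - 1), hV0]
  have h2 : 8 / 3 * V ^ 2 * (q / (2 * h ^ 4) + 3 / (2 * h ^ 2)) + 2 * V * ‖v - u‖ / h ^ 2 ≤
      (4 * V ^ 2 + V) / h ^ 2 + (4 * V ^ 2 / (3 * h ^ 4) + V / h ^ 2) * q := by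
    have h3 : 2 * V * ‖v - u‖ / h ^ 2 ≤ V * (1 + q) / h ^ 2 := div_le_div_of_nonneg_right h1 (by positivity)
    have e : 8 / 3 * V ^ 2 * (q / (2 * h ^ 4) + 3 / (2 * h ^ 2)) + V * (1 + q) / h ^ 2 =
        (4 * V ^ 2 + V) / h ^ 2 + (4 * V ^ 2 / (3 * h ^ 4) + V / h ^ 2) * q := by field_simp; ring
    linarith only [h3, e]
  have hw : 0 ≤ c₀ + q / (2 * h ^ 2) := by positivity
  have e2 : (c₀ + q / (2 * h ^ 2)) * ((4 * V ^ 2 + V) / h ^ 2 + (4 * V ^ 2 / (3 * h ^ 4) + V / h ^ 2) * q) =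
      c₀ * ((4 * V ^ 2 + V) / h ^ 2) + (c₀ * (4 * V ^ 2 / (3 * h ^ 4) + V / h ^ 2) + (4 * V ^ 2 + V) / h ^ 2 / (2 * h ^ 2)) * q +
        (4 * V ^ 2 / (3 * h ^ 4) + V / h ^ 2) / (2 * h ^ 2) * q ^ 2 := by ring
  have hq4 : q ^ 2 = ‖v - u‖ ^ 4 := by rw [hq]; ring
  calc (c₀ + q / (2 * h ^ 2)) * (8 / 3 * V ^ 2 * (q / (2 * h ^ 4) + 3 / (2 * h ^ 2)) + 2 * V * ‖v - u‖ / h ^ 2)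
      ≤ (c₀ + q / (2 * h ^ 2)) * ((4 * V ^ 2 + V) / h ^ 2 + (4 * V ^ 2 / (3 * h ^ 4) + V / h ^ 2) * q) :=
        mul_le_mul_of_nonneg_left h2 hw
    _ = _ := by rw [e2, hq4]

/-! ## The integrated bound -/

set_option maxHeartbeats 400000 in
-- a long but elementary chain of explicit Gaussian-moment evaluations
/-- **THE INTEGRATED BOUND.** `∫ |(1 + log f̂(v)) dF(v)| dv ≤ B₁ · Q(V,h,δ)` with the explicit
`Q = 2 (cm + 3Θ/(2h²)) + cm a₀ + 3Θ (cm a₁ + a₀/(2h²)) + K₄ Θ² a₁/(2h²)`, `Θ = h² + (2V)²/3`,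
`cm = 1 + |log (2πh²)^{-3/2}| + |log δ| + (3/2)(|log 2πh²| + |log 2πΘ|)`. -/
theorem integral_abs_integrand_le (hψ : ∀ y, 0 ≤ ψ N y) (hh : 0 < h) (hδ : 0 < δ) (hδ1 : δ ≤ 1) {V : ℝ}
    (hV : ∀ i, ‖(w i).2‖ ≤ V) :
    ∫ v, |(1 + Real.log (cellLaw N ψ h δ w x v)) * ((1 - δ) * (-(∑ i, Literature.Analysis.FunctionSpaces.Torus.fderiv (ψ N) ((w i).1 - x) (w i).2) *
        kde N ψ h w x (v) + ∑ i, Literature.Analysis.FunctionSpaces.Torus.fderiv (ψ N) ((w i).1 - x) (w i).2 * gauss h (w i).2 (v)) + δ *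
        (localMaxwellian 1 (cT N ψ w x + h ^ 2) (cU N ψ w x) (v) * ((-(∑ i, Literature.Analysis.FunctionSpaces.Torus.fderiv (ψ N) ((w i).1 -
        x) (w i).2) * cT N ψ w x + ∑ i, Literature.Analysis.FunctionSpaces.Torus.fderiv (ψ N) ((w i).1 - x) (w i).2 * (‖(w i).2 -
        cU N ψ w x‖ ^ 2 / 3)) * (‖(v) - cU N ψ w x‖ ^ 2 / (2 * (cT N ψ w x + h ^ 2) ^ 2) - 3 / (2 * (cT N ψ w x + h ^ 2))) + inner ℝ ((v) -
        cU N ψ w x) (-(∑ i, Literature.Analysis.FunctionSpaces.Torus.fderiv (ψ N) ((w i).1 - x) (w i).2) • cU N ψ w x +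
        ∑ i, Literature.Analysis.FunctionSpaces.Torus.fderiv (ψ N) ((w i).1 - x) (w i).2 • (w i).2) / (cT N ψ w x + h ^ 2))))| ≤
        (∑ i, |Literature.Analysis.FunctionSpaces.Torus.fderiv (ψ N) ((w i).1 - x) (w i).2|) *
      (2 * ((1 + |Real.log ((2 * Real.pi * h ^ 2) ^ (-(3 : ℝ) / 2))| + |Real.log δ| +
          3 / 2 * (|Real.log (2 * Real.pi * h ^ 2)| + |Real.log (2 * Real.pi * (h ^ 2 + (2 * V) ^ 2 / 3))|)) +
            3 * (h ^ 2 + (2 * V) ^ 2 / 3) / (2 * h ^ 2)) +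
        (1 + |Real.log ((2 * Real.pi * h ^ 2) ^ (-(3 : ℝ) / 2))| + |Real.log δ| +
          3 / 2 * (|Real.log (2 * Real.pi * h ^ 2)| + |Real.log (2 * Real.pi * (h ^ 2 + (2 * V) ^ 2 / 3))|)) *
            ((4 * V ^ 2 + V) / h ^ 2) +
        3 * (h ^ 2 + (2 * V) ^ 2 / 3) * ((1 + |Real.log ((2 * Real.pi * h ^ 2) ^ (-(3 : ℝ) / 2))| + |Real.log δ| +
          3 / 2 * (|Real.log (2 * Real.pi * h ^ 2)| + |Real.log (2 * Real.pi * (h ^ 2 + (2 * V) ^ 2 / 3))|)) *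
            (4 * V ^ 2 / (3 * h ^ 4) + V / h ^ 2) + (4 * V ^ 2 + V) / h ^ 2 / (2 * h ^ 2)) +
        (∫ w, ‖w‖ ^ 4 ∂stdGaussian V3) * (h ^ 2 + (2 * V) ^ 2 / 3) ^ 2 *
          ((4 * V ^ 2 / (3 * h ^ 4) + V / h ^ 2) / (2 * h ^ 2))) := by
  have hV0 := V_nonneg w hV
  have hh2 : 0 < h ^ 2 := by positivity
  have hθ := theta_pos (h := h) w x hψ hh
  have hθle := theta_le (h := h) w x hψ hV
  have hB := B1_nonneg (ψ := ψ) w x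
  -- names for the constants
  obtain ⟨Θ, hΘ⟩ : ∃ Θ : ℝ, Θ = h ^ 2 + (2 * V) ^ 2 / 3 := ⟨_, rfl⟩
  obtain ⟨cm, hcm⟩ : ∃ c : ℝ, c = 1 + |Real.log ((2 * Real.pi * h ^ 2) ^ (-(3 : ℝ) / 2))| + |Real.log δ| +
      3 / 2 * (|Real.log (2 * Real.pi * h ^ 2)| + |Real.log (2 * Real.pi * (h ^ 2 + (2 * V) ^ 2 / 3))|) := ⟨_, rfl⟩
  obtain ⟨c₀, hc₀⟩ : ∃ c : ℝ, c = 1 + |Real.log ((2 * Real.pi * h ^ 2) ^ (-(3 : ℝ) / 2))| + |Real.log δ| +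
      3 / 2 * |Real.log (2 * Real.pi * (cT N ψ w x + h ^ 2))| := ⟨_, rfl⟩
  obtain ⟨a₀, ha₀⟩ : ∃ a : ℝ, a = (4 * V ^ 2 + V) / h ^ 2 := ⟨_, rfl⟩
  obtain ⟨a₁, ha₁⟩ : ∃ a : ℝ, a = 4 * V ^ 2 / (3 * h ^ 4) + V / h ^ 2 := ⟨_, rfl⟩
  obtain ⟨K4, hK4⟩ : ∃ K : ℝ, K = ∫ w, ‖w‖ ^ 4 ∂stdGaussian V3 := ⟨_, rfl⟩
  have hK40 : 0 ≤ K4 := by rw [hK4]; exact K4_nonneg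
  have hc₀0 : 0 ≤ c₀ := by rw [hc₀]; positivity
  have hcm0 : 0 ≤ cm := by rw [hcm]; positivity
  have ha₀0 : 0 ≤ a₀ := by rw [ha₀]; positivity
  have ha₁0 : 0 ≤ a₁ := by rw [ha₁]; positivity
  have hc₀m : c₀ ≤ cm := by
    rw [hc₀, hcm]; linarith [abs_log_between hh (h2_le_theta w x hψ) hθle]
  have hθΘ : cT N ψ w x + h ^ 2 ≤ Θ := by rw [hΘ]; exact hθle
  have hΘ0 : 0 < Θ := lt_of_lt_of_le hθ hθΘ
  rw [← hcm, ← hK4, ← ha₁, ← ha₀, ← hΘ]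
  -- the integrable majorant `R₂`
  set U : V3 := cU N ψ w x with hU
  set θ : ℝ := cT N ψ w x + h ^ 2 with hθdef
  set R₂ : V3 → ℝ := fun v => (∑ i, |Literature.Analysis.FunctionSpaces.Torus.fderiv (ψ N) ((w i).1 - x) (w i).2|) * (kde N ψ h w x v * (c₀ + 1 / (2 *
      h ^ 2) * ‖v - U‖ ^ 2)) +
    (∑ i, |Literature.Analysis.FunctionSpaces.Torus.fderiv (ψ N) ((w i).1 - x) (w i).2|) * (localMaxwellian 1 θ U v * (c₀ * a₀ + (c₀ * a₁ + a₀ / (2 *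
        h ^ 2)) * ‖v - U‖ ^ 2 +
      a₁ / (2 * h ^ 2) * ‖v - U‖ ^ 4)) +
    ∑ i, |Literature.Analysis.FunctionSpaces.Torus.fderiv (ψ N) ((w i).1 - x) (w i).2| *
      (gauss h (w i).2 v * (c₀ + 1 / (2 * h ^ 2) * ‖v - U‖ ^ 2)) with hR₂
  have hI1 : Integrable fun v => kde N ψ h w x v * (c₀ + 1 / (2 * h ^ 2) * ‖v - U‖ ^ 2) :=
    integrable_kde_mul w x fun i => integrable_lM_mul_poly hh2 _ c₀ _ U 2
  have hI2 : Integrable fun v => localMaxwellian 1 θ U v * (c₀ * a₀ + (c₀ * a₁ + a₀ / (2 * h ^ 2)) * ‖v - U‖ ^ 2 +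
      a₁ / (2 * h ^ 2) * ‖v - U‖ ^ 4) := by
    have h1 := integrable_lM_mul_poly hθ U (c₀ * a₀) (c₀ * a₁ + a₀ / (2 * h ^ 2)) U 2
    have h2 := integrable_lM_mul_poly hθ U 0 (a₁ / (2 * h ^ 2)) U 4
    refine (h1.add h2).congr (Eventually.of_forall fun v => ?_)
    simp only [Pi.add_apply]; ring
  have hI3 : ∀ i, Integrable fun v => gauss h (w i).2 v * (c₀ + 1 / (2 * h ^ 2) * ‖v - U‖ ^ 2) :=
    fun i => integrable_lM_mul_poly hh2 _ c₀ _ U 2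
  have hR₂I : Integrable R₂ :=
    ((hI1.const_mul _).add (hI2.const_mul _)).add (integrable_finsetSum _ fun i _ => (hI3 i).const_mul _)
  -- pointwise: `|integrand| ≤ R₂`
  have hpt : ∀ v, |(1 + Real.log (cellLaw N ψ h δ w x v)) * ((1 - δ) * (-(∑ i, Literature.Analysis.FunctionSpaces.Torus.fderiv (ψ N) ((w i).1 -
      x) (w i).2) * kde N ψ h w x (v) + ∑ i, Literature.Analysis.FunctionSpaces.Torus.fderiv (ψ N) ((w i).1 - x) (w i).2 * gauss h (w i).2 (v)) + δ *
      (localMaxwellian 1 (cT N ψ w x + h ^ 2) (cU N ψ w x) (v) * ((-(∑ i, Literature.Analysis.FunctionSpaces.Torus.fderiv (ψ N) ((w i).1 -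
      x) (w i).2) * cT N ψ w x + ∑ i, Literature.Analysis.FunctionSpaces.Torus.fderiv (ψ N) ((w i).1 - x) (w i).2 * (‖(w i).2 -
      cU N ψ w x‖ ^ 2 / 3)) * (‖(v) - cU N ψ w x‖ ^ 2 / (2 * (cT N ψ w x + h ^ 2) ^ 2) - 3 / (2 * (cT N ψ w x + h ^ 2))) + inner ℝ ((v) -
      cU N ψ w x) (-(∑ i, Literature.Analysis.FunctionSpaces.Torus.fderiv (ψ N) ((w i).1 - x) (w i).2) • cU N ψ w x +
      ∑ i, Literature.Analysis.FunctionSpaces.Torus.fderiv (ψ N) ((w i).1 - x) (w i).2 • (w i).2) / (cT N ψ w x + h ^ 2))))| ≤ R₂ v := by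
    intro v
    have hm := abs_integrand_le (δ := δ) w x hψ hh hδ hδ1 hV v
    rw [← hc₀] at hm
    refine hm.trans ?_
    have hlM := localMaxwellian_nonneg zero_le_one hθ.le U v
    have hfl := weight_mul_floorPoly_le hh hV0 hc₀0 v U
    rw [← ha₀, ← ha₁] at hfl
    have hw : 0 ≤ c₀ + ‖v - U‖ ^ 2 / (2 * h ^ 2) := by positivity
    have hk := kde_nonneg w x hψ hh v
    have hGi : ∀ i, 0 ≤ |Literature.Analysis.FunctionSpaces.Torus.fderiv (ψ N) ((w i).1 - x) (w i).2| * gauss h (w i).2 v :=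
      fun i => mul_nonneg (abs_nonneg _) (gauss_pos hh _ _).le
    have e1 : c₀ + ‖v - U‖ ^ 2 / (2 * h ^ 2) = c₀ + 1 / (2 * h ^ 2) * ‖v - U‖ ^ 2 := by ring
    -- distribute the weight and compare term by term
    have key : (c₀ + ‖v - U‖ ^ 2 / (2 * h ^ 2)) * (localMaxwellian 1 θ U v *
        (8 / 3 * V ^ 2 * (‖v - U‖ ^ 2 / (2 * h ^ 4) + 3 / (2 * h ^ 2)) + 2 * V * ‖v - U‖ / h ^ 2)) ≤
        localMaxwellian 1 θ U v * (c₀ * a₀ + (c₀ * a₁ + a₀ / (2 * h ^ 2)) * ‖v - U‖ ^ 2 + a₁ / (2 * h ^ 2) * ‖v - U‖ ^ 4) := by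
      rw [mul_left_comm]
      exact mul_le_mul_of_nonneg_left hfl hlM
    rw [hR₂]
    simp only
    rw [e1] at hw ⊢
    rw [e1] at key
    have e2 : (c₀ + 1 / (2 * h ^ 2) * ‖v - U‖ ^ 2) * ((∑ i, |Literature.Analysis.FunctionSpaces.Torus.fderiv (ψ N) ((w i).1 - x) (w i).2|) *
        (kde N ψ h w x v + localMaxwellian 1 θ U v *
        (8 / 3 * V ^ 2 * (‖v - U‖ ^ 2 / (2 * h ^ 4) + 3 / (2 * h ^ 2)) + 2 * V * ‖v - U‖ / h ^ 2)) +
        ∑ i, |Literature.Analysis.FunctionSpaces.Torus.fderiv (ψ N) ((w i).1 - x) (w i).2| * gauss h (w i).2 v) =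
        (∑ i, |Literature.Analysis.FunctionSpaces.Torus.fderiv (ψ N) ((w i).1 - x) (w i).2|) * (kde N ψ h w x v * (c₀ + 1 / (2 * h ^ 2) * ‖v -
            U‖ ^ 2)) +
        (∑ i, |Literature.Analysis.FunctionSpaces.Torus.fderiv (ψ N) ((w i).1 - x) (w i).2|) * ((c₀ + 1 / (2 * h ^ 2) * ‖v - U‖ ^ 2) *
            (localMaxwellian 1 θ U v *
          (8 / 3 * V ^ 2 * (‖v - U‖ ^ 2 / (2 * h ^ 4) + 3 / (2 * h ^ 2)) + 2 * V * ‖v - U‖ / h ^ 2))) +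
        ∑ i, |Literature.Analysis.FunctionSpaces.Torus.fderiv (ψ N) ((w i).1 - x) (w i).2| *
          (gauss h (w i).2 v * (c₀ + 1 / (2 * h ^ 2) * ‖v - U‖ ^ 2)) := by
      have : ∀ i, (c₀ + 1 / (2 * h ^ 2) * ‖v - U‖ ^ 2) *
          (|Literature.Analysis.FunctionSpaces.Torus.fderiv (ψ N) ((w i).1 - x) (w i).2| * gauss h (w i).2 v) =
          |Literature.Analysis.FunctionSpaces.Torus.fderiv (ψ N) ((w i).1 - x) (w i).2| *
            (gauss h (w i).2 v * (c₀ + 1 / (2 * h ^ 2) * ‖v - U‖ ^ 2)) := fun i => by ring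
      rw [mul_add, Finset.mul_sum, Finset.sum_congr rfl fun i _ => this i]
      ring
    rw [e2]
    have := mul_le_mul_of_nonneg_left key hB
    linarith
  -- integrate
  have hmono := integral_mono_of_nonneg (Eventually.of_forall fun v => abs_nonneg _) hR₂I (Eventually.of_forall hpt)
  refine hmono.trans ?_
  -- evaluate `∫ R₂`
  have hJ1 : Integrable fun v => (∑ i, |Literature.Analysis.FunctionSpaces.Torus.fderiv (ψ N) ((w i).1 - x) (w i).2|) * (kde N ψ h w x v * (c₀ +
      1 / (2 * h ^ 2) * ‖v - U‖ ^ 2)) := hI1.const_mul _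
  have hJ2 : Integrable fun v => (∑ i, |Literature.Analysis.FunctionSpaces.Torus.fderiv (ψ N) ((w i).1 - x) (w i).2|) * (localMaxwellian 1 θ U v *
      (c₀ * a₀ + (c₀ * a₁ + a₀ / (2 * h ^ 2)) * ‖v - U‖ ^ 2 +
      a₁ / (2 * h ^ 2) * ‖v - U‖ ^ 4)) := hI2.const_mul _
  have hJ3 : ∀ i, Integrable fun v => |Literature.Analysis.FunctionSpaces.Torus.fderiv (ψ N) ((w i).1 - x) (w i).2| *
      (gauss h (w i).2 v * (c₀ + 1 / (2 * h ^ 2) * ‖v - U‖ ^ 2)) := fun i => (hI3 i).const_mul _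
  have hJ12 : Integrable fun v => (∑ i, |Literature.Analysis.FunctionSpaces.Torus.fderiv (ψ N) ((w i).1 - x) (w i).2|) * (kde N ψ h w x v * (c₀ +
      1 / (2 * h ^ 2) * ‖v - U‖ ^ 2)) +
      (∑ i, |Literature.Analysis.FunctionSpaces.Torus.fderiv (ψ N) ((w i).1 - x) (w i).2|) * (localMaxwellian 1 θ U v * (c₀ * a₀ + (c₀ * a₁ +
          a₀ / (2 * h ^ 2)) * ‖v - U‖ ^ 2 +
        a₁ / (2 * h ^ 2) * ‖v - U‖ ^ 4)) := hJ1.add hJ2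
  have hJ3s : Integrable fun v => ∑ i, |Literature.Analysis.FunctionSpaces.Torus.fderiv (ψ N) ((w i).1 - x) (w i).2| *
      (gauss h (w i).2 v * (c₀ + 1 / (2 * h ^ 2) * ‖v - U‖ ^ 2)) := integrable_finsetSum _ fun i _ => hJ3 i
  have eR : ∫ v, R₂ v = (∑ i, |Literature.Analysis.FunctionSpaces.Torus.fderiv (ψ N) ((w i).1 - x) (w i).2|) * (∫ v, kde N ψ h w x v * (c₀ + 1 / (2 *
      h ^ 2) * ‖v - U‖ ^ 2)) +
      (∑ i, |Literature.Analysis.FunctionSpaces.Torus.fderiv (ψ N) ((w i).1 - x) (w i).2|) * (∫ v, localMaxwellian 1 θ U v * (c₀ * a₀ + (c₀ * a₁ +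
          a₀ / (2 * h ^ 2)) * ‖v - U‖ ^ 2 +
        a₁ / (2 * h ^ 2) * ‖v - U‖ ^ 4)) +
      ∑ i, |Literature.Analysis.FunctionSpaces.Torus.fderiv (ψ N) ((w i).1 - x) (w i).2| *
        ∫ v, gauss h (w i).2 v * (c₀ + 1 / (2 * h ^ 2) * ‖v - U‖ ^ 2) := by
    rw [hR₂]
    simp only
    rw [integral_add hJ12 hJ3s, integral_add hJ1 hJ2, integral_const_mul, integral_const_mul,
      integral_finsetSum _ fun i _ => hJ3 i]
    congr 1
    exact Finset.sum_congr rfl fun i _ => integral_const_mul _ _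
  rw [eR, integral_lM_mul_quad hθ, ← hK4]
  have h1 := integral_kde_mul_affine_le w x hψ hh hV hc₀0 (by positivity : (0 : ℝ) ≤ 1 / (2 * h ^ 2))
  have h3 : ∀ i, ∫ v, gauss h (w i).2 v * (c₀ + 1 / (2 * h ^ 2) * ‖v - U‖ ^ 2) ≤ c₀ + 1 / (2 * h ^ 2) * (3 * h ^ 2 + 4 * V ^ 2) := by
    intro i
    show ∫ v, localMaxwellian 1 (h ^ 2) (w i).2 v * (c₀ + 1 / (2 * h ^ 2) * ‖v - U‖ ^ 2) ≤ _
    rw [integral_lM_mul_affine_sq hh2]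
    have : ‖(w i).2 - U‖ ^ 2 ≤ (2 * V) ^ 2 := pow_le_pow_left₀ (norm_nonneg _) (norm_vel_sub_cU_le w x hψ hV i) 2
    have hB0 : (0 : ℝ) ≤ 1 / (2 * h ^ 2) := by positivity
    nlinarith
  have h3' : ∑ i, |Literature.Analysis.FunctionSpaces.Torus.fderiv (ψ N) ((w i).1 - x) (w i).2| *
      ∫ v, gauss h (w i).2 v * (c₀ + 1 / (2 * h ^ 2) * ‖v - U‖ ^ 2) ≤ (∑ i, |Literature.Analysis.FunctionSpaces.Torus.fderiv (ψ N) ((w i).1 -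
          x) (w i).2|) * (c₀ + 1 / (2 * h ^ 2) * (3 * h ^ 2 + 4 * V ^ 2)) := by
    rw [Finset.sum_mul]
    exact Finset.sum_le_sum fun i _ => mul_le_mul_of_nonneg_left (h3 i) (abs_nonneg _)
  have hΘeq : 3 * h ^ 2 + 4 * V ^ 2 = 3 * Θ := by rw [hΘ]; ring
  rw [hΘeq] at h1 h3'
  have h2 : c₀ * a₀ + (c₀ * a₁ + a₀ / (2 * h ^ 2)) * (3 * θ) + a₁ / (2 * h ^ 2) * (K4 * θ ^ 2) ≤
      cm * a₀ + 3 * Θ * (cm * a₁ + a₀ / (2 * h ^ 2)) + K4 * Θ ^ 2 * (a₁ / (2 * h ^ 2)) := by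
    have hθ2 : θ ^ 2 ≤ Θ ^ 2 := pow_le_pow_left₀ hθ.le hθΘ 2
    have t1 : c₀ * a₀ ≤ cm * a₀ := mul_le_mul_of_nonneg_right hc₀m ha₀0
    have t2 : (c₀ * a₁ + a₀ / (2 * h ^ 2)) * (3 * θ) ≤ (cm * a₁ + a₀ / (2 * h ^ 2)) * (3 * Θ) :=
      mul_le_mul (add_le_add (mul_le_mul_of_nonneg_right hc₀m ha₁0) le_rfl) (by linarith) (by positivity) (by positivity)
    have t3 : a₁ / (2 * h ^ 2) * (K4 * θ ^ 2) ≤ a₁ / (2 * h ^ 2) * (K4 * Θ ^ 2) :=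
      mul_le_mul_of_nonneg_left (mul_le_mul_of_nonneg_left hθ2 hK40) (by positivity)
    linarith
  have h1' : ∫ v, kde N ψ h w x v * (c₀ + 1 / (2 * h ^ 2) * ‖v - U‖ ^ 2) ≤ cm + 3 * Θ / (2 * h ^ 2) := by
    have : c₀ + 1 / (2 * h ^ 2) * (3 * Θ) = c₀ + 3 * Θ / (2 * h ^ 2) := by ring
    linarith
  have h3'' : (∑ i, |Literature.Analysis.FunctionSpaces.Torus.fderiv (ψ N) ((w i).1 - x) (w i).2|) * (c₀ + 1 / (2 * h ^ 2) * (3 * Θ)) ≤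
      (∑ i, |Literature.Analysis.FunctionSpaces.Torus.fderiv (ψ N) ((w i).1 - x) (w i).2|) * (cm + 3 * Θ / (2 * h ^ 2)) := by
    refine mul_le_mul_of_nonneg_left ?_ hB
    have : c₀ + 1 / (2 * h ^ 2) * (3 * Θ) = c₀ + 3 * Θ / (2 * h ^ 2) := by ring
    linarith
  have s1 := mul_le_mul_of_nonneg_left h1' hB
  have s2 := mul_le_mul_of_nonneg_left h2 hB
  have e : (∑ i, |Literature.Analysis.FunctionSpaces.Torus.fderiv (ψ N) ((w i).1 - x) (w i).2|) * (2 * (cm + 3 * Θ / (2 * h ^ 2)) + cm * a₀ + 3 * Θ *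
      (cm * a₁ + a₀ / (2 * h ^ 2)) +
      K4 * Θ ^ 2 * (a₁ / (2 * h ^ 2))) = (∑ i, |Literature.Analysis.FunctionSpaces.Torus.fderiv (ψ N) ((w i).1 - x) (w i).2|) * (cm + 3 * Θ / (2 *
          h ^ 2)) +
      (∑ i, |Literature.Analysis.FunctionSpaces.Torus.fderiv (ψ N) ((w i).1 - x) (w i).2|) * (cm * a₀ + 3 * Θ * (cm * a₁ + a₀ / (2 * h ^ 2)) + K4 *
          Θ ^ 2 * (a₁ / (2 * h ^ 2))) +
      (∑ i, |Literature.Analysis.FunctionSpaces.Torus.fderiv (ψ N) ((w i).1 - x) (w i).2|) * (cm + 3 * Θ / (2 * h ^ 2)) := by ring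
  rw [e]
  linarith only [s1, s2, h3', h3'']


/-- **THE TRANSPORTED MASS-WEIGHTED ENTROPY DENSITY IS `O(B₁)`:**
`|D_x| = |(Σβ) H(f̂_x) + ∫ (1 + log f̂) dF| ≤ B₁ · (M(V,h,δ) + Q(V,h,δ))`. -/
theorem abs_Dx_le (hψ : ∀ y, 0 ≤ ψ N y) (hh : 0 < h) (hδ : 0 < δ) (hδ1 : δ ≤ 1) {V : ℝ} (hV : ∀ i, ‖(w i).2‖ ≤ V) :
    |(∑ i, Literature.Analysis.FunctionSpaces.Torus.fderiv (ψ N) ((w i).1 - x) (w i).2) * cellEnt N ψ h δ w x + ∫ v, (1 +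
        Real.log (cellLaw N ψ h δ w x v)) * ((1 - δ) * (-(∑ i, Literature.Analysis.FunctionSpaces.Torus.fderiv (ψ N) ((w i).1 - x) (w i).2) *
        kde N ψ h w x (v) + ∑ i, Literature.Analysis.FunctionSpaces.Torus.fderiv (ψ N) ((w i).1 - x) (w i).2 * gauss h (w i).2 (v)) + δ *
        (localMaxwellian 1 (cT N ψ w x + h ^ 2) (cU N ψ w x) (v) * ((-(∑ i, Literature.Analysis.FunctionSpaces.Torus.fderiv (ψ N) ((w i).1 -
        x) (w i).2) * cT N ψ w x + ∑ i, Literature.Analysis.FunctionSpaces.Torus.fderiv (ψ N) ((w i).1 - x) (w i).2 * (‖(w i).2 -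
        cU N ψ w x‖ ^ 2 / 3)) * (‖(v) - cU N ψ w x‖ ^ 2 / (2 * (cT N ψ w x + h ^ 2) ^ 2) - 3 / (2 * (cT N ψ w x + h ^ 2))) + inner ℝ ((v) -
        cU N ψ w x) (-(∑ i, Literature.Analysis.FunctionSpaces.Torus.fderiv (ψ N) ((w i).1 - x) (w i).2) • cU N ψ w x +
        ∑ i, Literature.Analysis.FunctionSpaces.Torus.fderiv (ψ N) ((w i).1 - x) (w i).2 • (w i).2) / (cT N ψ w x + h ^ 2))))| ≤
        (∑ i, |Literature.Analysis.FunctionSpaces.Torus.fderiv (ψ N) ((w i).1 - x) (w i).2|) *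
      ((|Real.log ((2 * Real.pi * h ^ 2) ^ (-(3 : ℝ) / 2))| + |Real.log δ| +
          3 / 2 * (|Real.log (2 * Real.pi * h ^ 2)| + |Real.log (2 * Real.pi * (h ^ 2 + (2 * V) ^ 2 / 3))|) + 3 / 2) +
      (2 * ((1 + |Real.log ((2 * Real.pi * h ^ 2) ^ (-(3 : ℝ) / 2))| + |Real.log δ| +
          3 / 2 * (|Real.log (2 * Real.pi * h ^ 2)| + |Real.log (2 * Real.pi * (h ^ 2 + (2 * V) ^ 2 / 3))|)) +
            3 * (h ^ 2 + (2 * V) ^ 2 / 3) / (2 * h ^ 2)) +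
        (1 + |Real.log ((2 * Real.pi * h ^ 2) ^ (-(3 : ℝ) / 2))| + |Real.log δ| +
          3 / 2 * (|Real.log (2 * Real.pi * h ^ 2)| + |Real.log (2 * Real.pi * (h ^ 2 + (2 * V) ^ 2 / 3))|)) *
            ((4 * V ^ 2 + V) / h ^ 2) +
        3 * (h ^ 2 + (2 * V) ^ 2 / 3) * ((1 + |Real.log ((2 * Real.pi * h ^ 2) ^ (-(3 : ℝ) / 2))| + |Real.log δ| +
          3 / 2 * (|Real.log (2 * Real.pi * h ^ 2)| + |Real.log (2 * Real.pi * (h ^ 2 + (2 * V) ^ 2 / 3))|)) *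
            (4 * V ^ 2 / (3 * h ^ 4) + V / h ^ 2) + (4 * V ^ 2 + V) / h ^ 2 / (2 * h ^ 2)) +
        (∫ w, ‖w‖ ^ 4 ∂stdGaussian V3) * (h ^ 2 + (2 * V) ^ 2 / 3) ^ 2 *
          ((4 * V ^ 2 / (3 * h ^ 4) + V / h ^ 2) / (2 * h ^ 2)))) := by
  have h1 := integral_abs_integrand_le (δ := δ) w x hψ hh hδ hδ1 hV
  have h2 := abs_cellEnt_le_unif (δ := δ) w x hψ hh hδ hδ1 hV
  have h3 := abs_dS_le (ψ := ψ) w x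
  have hB := B1_nonneg (ψ := ψ) w x
  have h4 : |(∑ i, Literature.Analysis.FunctionSpaces.Torus.fderiv (ψ N) ((w i).1 - x) (w i).2) * cellEnt N ψ h δ w x| ≤
      (∑ i, |Literature.Analysis.FunctionSpaces.Torus.fderiv (ψ N) ((w i).1 - x) (w i).2|) *
      (|Real.log ((2 * Real.pi * h ^ 2) ^ (-(3 : ℝ) / 2))| + |Real.log δ| +
        3 / 2 * (|Real.log (2 * Real.pi * h ^ 2)| + |Real.log (2 * Real.pi * (h ^ 2 + (2 * V) ^ 2 / 3))|) + 3 / 2) := by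
    rw [abs_mul]
    exact mul_le_mul h3 h2 (abs_nonneg _) hB
  calc _ ≤ _ := abs_add_le _ _
    _ ≤ _ := add_le_add h4 (abs_integral_le_integral_abs.trans h1)
    _ = _ := by ring


/-- The size constant `M(V,h,δ) + Q(V,h,δ)` of `abs_Dx_le` is nonnegative. -/
theorem Rv_nonneg (h δ : ℝ) {V : ℝ} (hV0 : 0 ≤ V) : 0 ≤
      ((|Real.log ((2 * Real.pi * h ^ 2) ^ (-(3 : ℝ) / 2))| + |Real.log δ| +
          3 / 2 * (|Real.log (2 * Real.pi * h ^ 2)| + |Real.log (2 * Real.pi * (h ^ 2 + (2 * V) ^ 2 / 3))|) + 3 / 2) +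
      (2 * ((1 + |Real.log ((2 * Real.pi * h ^ 2) ^ (-(3 : ℝ) / 2))| + |Real.log δ| +
          3 / 2 * (|Real.log (2 * Real.pi * h ^ 2)| + |Real.log (2 * Real.pi * (h ^ 2 + (2 * V) ^ 2 / 3))|)) +
            3 * (h ^ 2 + (2 * V) ^ 2 / 3) / (2 * h ^ 2)) +
        (1 + |Real.log ((2 * Real.pi * h ^ 2) ^ (-(3 : ℝ) / 2))| + |Real.log δ| +
          3 / 2 * (|Real.log (2 * Real.pi * h ^ 2)| + |Real.log (2 * Real.pi * (h ^ 2 + (2 * V) ^ 2 / 3))|)) *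
            ((4 * V ^ 2 + V) / h ^ 2) +
        3 * (h ^ 2 + (2 * V) ^ 2 / 3) * ((1 + |Real.log ((2 * Real.pi * h ^ 2) ^ (-(3 : ℝ) / 2))| + |Real.log δ| +
          3 / 2 * (|Real.log (2 * Real.pi * h ^ 2)| + |Real.log (2 * Real.pi * (h ^ 2 + (2 * V) ^ 2 / 3))|)) *
            (4 * V ^ 2 / (3 * h ^ 4) + V / h ^ 2) + (4 * V ^ 2 + V) / h ^ 2 / (2 * h ^ 2)) +
        (∫ w, ‖w‖ ^ 4 ∂stdGaussian V3) * (h ^ 2 + (2 * V) ^ 2 / 3) ^ 2 *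
          ((4 * V ^ 2 / (3 * h ^ 4) + V / h ^ 2) / (2 * h ^ 2)))) := by
  have := K4_nonneg
  positivity

end EntropyBudget

/-- Registered anchor of this helper file (`--supports stmt-AtomisticToContinuum-14868`, helper of
`stub_entropyBudget`): the affine-in-|v-c|² Gaussian moment behind the integrated size of the transported entropy density. -/
theorem bhEntropyBudget_derivInt_anchor : ∀ (θ : ℝ), 0 < θ → ∀ (u c : V3) (A B : ℝ), ∫ v, Literature.Analysis.FluidPDE.localMaxwellian 1 θ u v * (A +
    B * ‖v - c‖ ^ 2) = A + B * (3 * θ + ‖u - c‖ ^ 2) :=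
  fun _ hθ u c A B => EntropyBudget.integral_lM_mul_affine_sq hθ u c A B

end

end Summit.AtomisticToContinuum.HydrodynamicLimit.Theorems.BlockHDissipation
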